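import Summits.BirchSwinnertonDyer.BirchSwinnertonDyer.Theses.GenusKolyvaginAtTwo
import Summits.BirchSwinnertonDyer.BirchSwinnertonDyer.Theorems.GenusKolyvaginAtTwoGenusPrimitiveSupplyAtTwoLoweringStepNoTwoTorsion
import Summits.BirchSwinnertonDyer.BirchSwinnertonDyer.Theorems.SchneiderFreeAdditiveX3PoitouTateReciprocitySumHolds
import Summits.BirchSwinnertonDyer.Rank1Residual.GaloisImage.LocalEulerPoincareCharacteristicHolds
import HarnessLib

/-!
# Route `GenusKolyvaginAtTwo`: item 24950 `MazurRubinProp52Rat` CLOSED BY NAME —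
# Mazur–Rubin 2010 Prop. 5.2 over `ℚ` (`MazurRubin2010.prop52_rat`) is a TREE THEOREM

Lead seat `bsd-line-gk2-p1` g9 (cell `bsd-f1-sign2`). THEOREMS ONLY (no definition, no named fact, no `sorry`).

The lineage's g8 file `…GenusPrimitiveSupplyAtTwoLoweringStepNoTwoTorsion` proved
`GenusKolyLowering.prop52_rat_of_duality : poitouTate_selmerStructure_duality_real ℚ →
(∀ v, localEulerPoincareCharacteristic ℚ_v) → MazurRubin2010.prop52_rat` (Mazur–Rubin 2010 Prop. 5.2 over `ℚ` as
printed — `E(ℚ)[2] = 0`, any model — from Lemma 3.6, Čebotarev, the index-4 transfer Cor. 3.4 (i) with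
`dim V_T = 2`, Lemma 2.11 and the `d = +p` place menu), leaving the two standard duality facts as binders. Both
binders are THEOREMS of the tree:

* `SchneiderFreeAdditiveX3.PoitouTateReduction.poitouTate_selmerStructure_duality_real_holds` — Poitou–Tate duality
  for Selmer structures with conditions at the real places (Milne ADT I Thm. 4.10 (b) + Howard Thm. 2.1.11), every
  number field;
* `Literature.NumberTheory.GaloisRepresentations.localEulerPoincareCharacteristic_holds` — Tate's local Euler–Poincaré
  characteristic formula, every non-archimedean local field of characteristic `0` (the `CharZero ℚ_v` instance is
  supplied from the injectivity of `ℚ → ℚ_v`, as in `…ByReductionTypeAtTwoGoodOrdTowerControlAllP.localEP_rat`).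

Feeding them discharges the named fact and closes the route item:

* `Literature.NumberTheory.EllipticCurves.MazurRubin2010.prop52_rat_holds : MazurRubin2010.prop52_rat` — the
  DISCHARGE of the Literature named fact (`TwistSelmerRankLowering.lean`), unconditional;
* `mazurRubinProp52Rat_proof : Theses.GenusKolyvaginAtTwo.MazurRubinProp52Rat` — route item
  stmt-BirchSwinnertonDyer-24950 BY NAME.

Consequence for the crux stmt-BirchSwinnertonDyer-22136 `GenusPrimitiveSupplyAtTwo`: the print input
«Mazur–Rubin 2010 Prop. 5.2» of its twin-supply half is no longer a hypothesis anywhere in the cone; the crux stays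
open exactly at (U = `MultiGenusPrimitivityAtTwo`, 24947) ∧ (CONV₂ = `RankOneTwoConverse`, 19220/24948). BSD is not
proved by any of this.

References: [MazurRubin2010] B. Mazur, K. Rubin, *Ranks of twists of elliptic curves and Hilbert's tenth problem*,
Invent. Math. 181 (2010), Prop. 5.2 (arXiv:0904.3709 p. 12), Lemma 3.6 (p. 9), Cor. 3.4 (i); [MilneADT2006] I Thm. 2.8,
Thm. 4.10; [SerreGaloisCohomology1997] II §5.7.
-/

set_option linter.dupNamespace false -- tree convention: `Summit.BirchSwinnertonDyer.BirchSwinnertonDyer.Theorems` (summit = sub-problem)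
set_option autoImplicit false

noncomputable section

open IsDedekindDomain NumberField
open Literature.NumberTheory.EllipticCurves Literature.NumberTheory.GaloisRepresentations
open Literature.NumberTheory.GaloisCohomology
open Summit.BirchSwinnertonDyer.BirchSwinnertonDyer.Theorems

/-- **Mazur–Rubin 2010 Prop. 5.2 over `ℚ` HOLDS** — DISCHARGE of the named fact `MazurRubin2010.prop52_rat`: for every
elliptic curve `E/ℚ` (any Weierstrass model `W`) with `#W(ℚ)[2] = 1` and `#Sel₂(W) = 2^s`, `s > 1`, and every modulus
`m ≠ 0`, there is a prime `p ≡ 1 (mod m)` with `#Sel₂(W^{(p)}) = 2^{s-2}`. Proof: the lineage's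
`GenusKolyLowering.prop52_rat_of_duality` (Lemma 3.6 + Čebotarev + Cor. 3.4 (i) with `dim V_T = 2` + Lemma 2.11 + the
`d = +p` place menu, any model via a global minimal model) fed with the tree theorems
`PoitouTateReduction.poitouTate_selmerStructure_duality_real_holds` (Poitou–Tate, real places) and
`localEulerPoincareCharacteristic_holds` (Tate χ).
[cite: MazurRubin2010, Prop. 5.2 and its proof (arXiv:0904.3709 p. 12), Lemma 3.6 (p. 9), Cor. 3.4 (i)]
[cite: MilneADT2006, Ch. I, Thm. 2.8 and Thm. 4.10] -/
theorem _root_.Literature.NumberTheory.EllipticCurves.MazurRubin2010.prop52_rat_holds : MazurRubin2010.prop52_rat :=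
  GenusKolyLowering.prop52_rat_of_duality
    (SchneiderFreeAdditiveX3.PoitouTateReduction.poitouTate_selmerStructure_duality_real_holds (K := ℚ))
    (fun v =>
      haveI : CharZero (v.adicCompletion ℚ) := charZero_of_injective_algebraMap (algebraMap ℚ _).injective
      localEulerPoincareCharacteristic_holds (v.adicCompletion ℚ))

namespace Summit.BirchSwinnertonDyer.BirchSwinnertonDyer.Theorems

/-- **Route item stmt-BirchSwinnertonDyer-24950 `MazurRubinProp52Rat` BY NAME**: the route's by-name alias of
Mazur–Rubin 2010 Prop. 5.2 over `ℚ` (`MazurRubin2010.prop52_rat`: twists lowering the 2-Selmer rank by two at a prime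
`p ≡ 1 (mod m)`, `E(ℚ)[2] = 0`), now a theorem of the tree (`MazurRubin2010.prop52_rat_holds`).
[cite: MazurRubin2010, Prop. 5.2 (arXiv:0904.3709 p. 12)] -/
theorem mazurRubinProp52Rat_proof :
    Summit.BirchSwinnertonDyer.BirchSwinnertonDyer.Theses.GenusKolyvaginAtTwo.MazurRubinProp52Rat := by
  unfold Summit.BirchSwinnertonDyer.BirchSwinnertonDyer.Theses.GenusKolyvaginAtTwo.MazurRubinProp52Rat
  exact MazurRubin2010.prop52_rat_holds

end Summit.BirchSwinnertonDyer.BirchSwinnertonDyer.Theorems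

end
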